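import Literature.MathematicalPhysics.QuantumFieldTheory.WilsonEnergyConvexity
import HarnessLib

/-!
# The mean Wilson action is STRICTLY decreasing in `β`

Finite-volume Wilson lattice gauge theory on the torus `(ℤ/Lℤ)^d` with an arbitrary compact gauge
group `G` and a continuous matrix representation `ρ` (tree objects `wilsonAction`, `wilsonMeasure`,
`wilsonExpectation` of `ConstructiveQFTWave0`).  The tree file `WilsonEnergyConvexity` proves that
`β ↦ ⟨S⟩_{Λ,β}` is non-increasing (the derivative-free form of `(log Z)'' = Var S ≥ 0`).  This file
adds the STRICT form, needed for the strict positivity of the plaquette expectation at `β ≠ 0`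
(`WilsonPlaquettePositivity`) and through it for the strict clause of Tomboulis's Prop. IV.1
(`TwistedPartitionFunctionStrict`):

* `wilsonExpectation_wilsonAction_strictAnti` — if the action is not identically zero then
  `β < β' ⟹ ⟨S⟩_{Λ,β'} < ⟨S⟩_{Λ,β}`.

Proof (derivative-free, one integral): with `m = ⟨S⟩_β` and `δ = β' - β > 0` the function
`(m - S)(e^{-δS} - e^{-δm}) e^{-βS}` is pointwise `≥ 0` (Chebyshev: `S ↦ e^{-δS}` is decreasing), is
`> 0` wherever `S ≠ m` (an open non-empty set, charged by product Haar measure), and its integral is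
`m Z(β') - ∫ S e^{-β'S}`; hence `⟨S⟩_{β'} < m`.  Nothing here is specific to gauge theories beyond
the tree's measurability and boundedness of the Wilson action; no derivative of `log Z` is taken.

## References

* S. Friedli, Y. Velenik, *Statistical Mechanics of Lattice Systems*, CUP 2017, Lemma 3.5 (p. 94)
  and App. B.8.1 (convexity of the finite-volume pressure; the energy is its derivative).
  [FriedliVelenik2017]
-/

noncomputable section

open MeasureTheory

namespace Literature.MathematicalPhysics.QuantumFieldTheory

variable {d L N : ℕ} {G : Type*} [Group G] [TopologicalSpace G] [IsTopologicalGroup G]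
  [CompactSpace G] [MeasurableSpace G] [BorelSpace G] (ρ : G →* Matrix (Fin N) (Fin N) ℂ)

/-! ### Strict monotonicity of the mean action in `β` -/

section StrictEnergy

/-- Chebyshev's pointwise inequality: `(m - a)(e^{-δa} - e^{-δm}) ≥ 0` for `δ > 0`. [folklore] -/
private theorem sub_mul_exp_sub_exp_nonneg {δ : ℝ} (hδ : 0 < δ) (m a : ℝ) :
    0 ≤ (m - a) * (Real.exp (-δ * a) - Real.exp (-δ * m)) := by
  rcases le_total a m with h | h
  · exact mul_nonneg (sub_nonneg.2 h) (sub_nonneg.2 (Real.exp_le_exp.2 (by nlinarith)))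
  · exact mul_nonneg_of_nonpos_of_nonpos (sub_nonpos.2 h)
      (sub_nonpos.2 (Real.exp_le_exp.2 (by nlinarith)))

/-- … with strict inequality when `a ≠ m`. [folklore] -/
private theorem sub_mul_exp_sub_exp_pos {δ : ℝ} (hδ : 0 < δ) {m a : ℝ} (h : a ≠ m) :
    0 < (m - a) * (Real.exp (-δ * a) - Real.exp (-δ * m)) := by
  rcases lt_or_gt_of_ne h with h | h
  · exact mul_pos (sub_pos.2 h) (sub_pos.2 (Real.exp_lt_exp.2 (by nlinarith)))
  · exact mul_pos_of_neg_of_neg (sub_neg.2 h) (sub_neg.2 (Real.exp_lt_exp.2 (by nlinarith)))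

/-- `U ↦ S(U) e^{c S(U)}` is integrable for product Haar measure (bounded, measurable). [folklore] -/
private theorem integrable_wilsonAction_mul_exp [NeZero L] (hρ : Continuous ρ) (c : ℝ) :
    Integrable (fun U : GaugeConfig d L G => wilsonAction ρ U * Real.exp (c * wilsonAction ρ U))
      (Measure.pi fun _ : Edge d L => haarProbability G) := by
  obtain ⟨B, hB⟩ := exists_abs_wilsonAction_le (d := d) (L := L) ρ hρ
  have hm : Measurable fun U : GaugeConfig d L G =>
      wilsonAction ρ U * Real.exp (c * wilsonAction ρ U) :=
    (WilsonRP.measurable_wilsonAction ρ hρ).mul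
      (Real.measurable_exp.comp ((WilsonRP.measurable_wilsonAction ρ hρ).const_mul c))
  refine Integrable.of_bound hm.aestronglyMeasurable (B * Real.exp (|c| * B))
    (ae_of_all _ fun U => ?_)
  rw [norm_mul, Real.norm_eq_abs, Real.norm_eq_abs, Real.abs_exp]
  refine mul_le_mul (hB U) (Real.exp_le_exp.2 ?_) (Real.exp_pos _).le
    ((abs_nonneg _).trans (hB U))
  calc c * wilsonAction ρ U ≤ |c * wilsonAction ρ U| := le_abs_self _
    _ = |c| * |wilsonAction ρ U| := abs_mul _ _
    _ ≤ |c| * B := mul_le_mul_of_nonneg_left (hB U) (abs_nonneg _)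

/-- **The mean Wilson action is STRICTLY decreasing in `β`** on every finite torus, for every
compact group and continuous representation whose action is not identically zero:
`β < β' ⟹ ⟨S⟩_{Λ,β'} < ⟨S⟩_{Λ,β}`.  (The energy is minus the derivative of the pressure
`log Z(β)`, which is strictly convex unless the Hamiltonian is constant; here derivative-free: with
`m = ⟨S⟩_β` and `δ = β' - β > 0`, `0 < ∫ (m - S)(e^{-δS} - e^{-δm}) e^{-βS} = m Z(β') - ∫ S e^{-β'S}`.)
The tree's `wilsonExpectation_wilsonAction_antitone` is the non-strict form.
[cite: FriedliVelenik2017, Lemma 3.5 (p. 94) and App. B.8.1] -/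
theorem wilsonExpectation_wilsonAction_strictAnti [NeZero L] (hρ : Continuous ρ)
    (hS : ∃ U : GaugeConfig d L G, wilsonAction ρ U ≠ 0) :
    StrictAnti fun β : ℝ => wilsonExpectation ρ β (wilsonAction (d := d) (L := L) (G := G) ρ) := by
  intro β β' hlt
  haveI : (haarProbability G).IsOpenPosMeasure := by unfold haarProbability; infer_instance
  set π : Measure (GaugeConfig d L G) := Measure.pi fun _ : Edge d L => haarProbability G with hπ
  set S : GaugeConfig d L G → ℝ := wilsonAction ρ with hSdef
  have hSm : Measurable S := WilsonRP.measurable_wilsonAction ρ hρ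
  have hSc : Continuous S := continuous_wilsonAction_of_continuous ρ hρ
  set δ : ℝ := β' - β with hδ
  have hδ0 : 0 < δ := sub_pos.2 hlt
  -- the four Gibbs integrals
  set Z : ℝ := ∫ U, Real.exp (-β * S U) ∂π with hZ
  set A : ℝ := ∫ U, S U * Real.exp (-β * S U) ∂π with hA
  set Z' : ℝ := ∫ U, Real.exp (-β' * S U) ∂π with hZ'
  set A' : ℝ := ∫ U, S U * Real.exp (-β' * S U) ∂π with hA'
  have hZpos : 0 < Z := integral_exp_neg_mul_wilsonAction_pos ρ hρ β
  have hZ'pos : 0 < Z' := integral_exp_neg_mul_wilsonAction_pos ρ hρ β'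
  show wilsonExpectation ρ β' S < wilsonExpectation ρ β S
  rw [wilsonExpectation_eq_integral_div ρ hρ β', wilsonExpectation_eq_integral_div ρ hρ β]
  show A' / Z' < A / Z
  set m : ℝ := A / Z with hm
  -- `e^{-δ S} e^{-β S} = e^{-β' S}`
  have hexp : ∀ U, Real.exp (-δ * S U) * Real.exp (-β * S U) = Real.exp (-β' * S U) := fun U => by
    rw [← Real.exp_add]; congr 1; rw [hδ]; ring
  -- the Chebyshev integrand
  set h : GaugeConfig d L G → ℝ := fun U =>
    (m - S U) * (Real.exp (-δ * S U) - Real.exp (-δ * m)) * Real.exp (-β * S U) with hh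
  have hh_nonneg : ∀ U, 0 ≤ h U := fun U =>
    mul_nonneg (sub_mul_exp_sub_exp_nonneg hδ0 m (S U)) (Real.exp_pos _).le
  have hh_cont : Continuous h :=
    ((continuous_const.sub hSc).mul
      ((Real.continuous_exp.comp (hSc.const_mul _)).sub continuous_const)).mul
      (Real.continuous_exp.comp (hSc.const_mul _))
  have i1 : Integrable (fun U => Real.exp (-β' * S U)) π :=
    integrable_exp_mul_wilsonAction ρ hρ (-β') π
  have i2 : Integrable (fun U => S U * Real.exp (-β' * S U)) π :=
    integrable_wilsonAction_mul_exp ρ hρ (-β')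
  have i3 : Integrable (fun U => Real.exp (-β * S U)) π :=
    integrable_exp_mul_wilsonAction ρ hρ (-β) π
  have i4 : Integrable (fun U => S U * Real.exp (-β * S U)) π :=
    integrable_wilsonAction_mul_exp ρ hρ (-β)
  have hstep : ∀ U, h U = (m * Real.exp (-β' * S U) - S U * Real.exp (-β' * S U))
      - (Real.exp (-δ * m) * m * Real.exp (-β * S U)
        - Real.exp (-δ * m) * (S U * Real.exp (-β * S U))) := fun U => by
    simp only [hh, ← hexp U]
    ring
  have hmZ : m * Z = A := by rw [hm, div_mul_cancel₀ A hZpos.ne']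
  have j12 : Integrable (fun U => m * Real.exp (-β' * S U) - S U * Real.exp (-β' * S U)) π :=
    (i1.const_mul m).sub i2
  have j34 : Integrable (fun U => Real.exp (-δ * m) * m * Real.exp (-β * S U)
      - Real.exp (-δ * m) * (S U * Real.exp (-β * S U))) π :=
    (i3.const_mul _).sub (i4.const_mul _)
  have hh_int : Integrable h π := by
    have : h = fun U => (m * Real.exp (-β' * S U) - S U * Real.exp (-β' * S U))
      - (Real.exp (-δ * m) * m * Real.exp (-β * S U)
        - Real.exp (-δ * m) * (S U * Real.exp (-β * S U))) := funext hstep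
    rw [this]
    exact j12.sub j34
  have hh_integral : ∫ U, h U ∂π = m * Z' - A' := by
    simp_rw [hstep]
    rw [integral_sub j12 j34,
      integral_sub (i1.const_mul m) i2, integral_sub (i3.const_mul _) (i4.const_mul _),
      integral_const_mul, integral_const_mul, integral_const_mul, ← hZ, ← hA, ← hZ', ← hA',
      show Real.exp (-δ * m) * m * Z = Real.exp (-δ * m) * A by rw [mul_assoc, hmZ]]
    ring
  -- `h > 0` somewhere: `S(1) = 0` and `S(U₁) ≠ 0`, so one of them differs from `m`
  have hh_pos : ∃ U, 0 < h U := by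
    obtain ⟨U₁, hU₁⟩ := hS
    have h1 : S 1 = 0 := wilsonAction_one_eq_zero (d := d) (L := L) ρ
    by_cases hm0 : m = 0
    · refine ⟨U₁, mul_pos (sub_mul_exp_sub_exp_pos hδ0 ?_) (Real.exp_pos _)⟩
      rw [hm0]; exact hU₁
    · refine ⟨1, mul_pos (sub_mul_exp_sub_exp_pos hδ0 ?_) (Real.exp_pos _)⟩
      rw [h1]; exact Ne.symm hm0
  -- hence `∫ h > 0`
  have hint_pos : 0 < ∫ U, h U ∂π := by
    obtain ⟨U₀, hU₀⟩ := hh_pos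
    rw [integral_pos_iff_support_of_nonneg_ae (ae_of_all _ hh_nonneg) hh_int]
    have hopen : IsOpen {U : GaugeConfig d L G | h U₀ / 2 < h U} :=
      isOpen_lt continuous_const hh_cont
    have hne : ({U : GaugeConfig d L G | h U₀ / 2 < h U}).Nonempty :=
      ⟨U₀, show h U₀ / 2 < h U₀ by linarith⟩
    refine (hopen.measure_pos π hne).trans_le (measure_mono fun U hU => ?_)
    have hU' : h U₀ / 2 < h U := hU
    exact (show 0 < h U by linarith).ne'
  rw [hh_integral] at hint_pos
  rw [div_lt_iff₀ hZ'pos]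
  calc A' < m * Z' := by linarith
    _ = A / Z * Z' := by rw [hm]

end StrictEnergy

end Literature.MathematicalPhysics.QuantumFieldTheory

end
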